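/-
Copyright (c) 2026 the pub-hodgecm-mathlib formalisation cell (harness21).  Prover seat hodgecm-mathlib-LH4-p07 (g9), req620 Track A «(D-RAM) FOUR-FRAME» squad
(STAGE-1b, row-(2) lineage; dealer LH4-plan (g13) WORD #58 RULING A ∕ #59 ∕ #64 ∕ #65: owner of the two-literal census law of `lev_{a,m}`, RamK lane), 2026-09-04.
-/
import Summits.HodgeConjecture.HodgeConjecture.Theorems.F0P3cDyRamToricCensusSumRamKWeld              -- ★ (F0P3-p01 (g33)): the unit weld + `add_le_of_not_topBit_far`; brings ★ TopValue, ★ (D0)–(D2), ★ third-field package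
import Summits.HodgeConjecture.HodgeConjecture.Theorems.F0P3cDyRamToricLevelCensusRamKTopValueScaled  -- ★ p859867 (this seat): (D3♯) `ncard_levelSetDep_top_ramK_eq_inv_mul`
import Summits.HodgeConjecture.HodgeConjecture.Theorems.F0P3cDyRamToricCensusSumRamKCutOffset          -- ★ p859832 (this seat): `cutSum_eq_of_agree_below_alive`
import Summits.HodgeConjecture.HodgeConjecture.Theorems.F0P3cDyRamToricCensusSumRamKFlip               -- ★ p859875 (LH4-p04 (g7)): (T5s♭-RamK) `toricCensusSum_ramK_flip_cut`
import HarnessLib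

/-!
# Crux `H413`, line LH4 «(D-RAM) FOUR-FRAME» — STAGE-1b, row (2): (T5-P-weldΔ)-RamK♭ «THE LEVEL-PIECE WELD, TYPE RamK, FLIPPED PARITY CLASS (odd `a′`)»
# `ε·Σ_{j ≤ jl₁} Σ_a q^a·[j + a ≤ C]·(#levelSetDep_h(j,a;t⁻¹μ) − #levelSetDep_{h′}(j,a;t⁻¹μ)) = q^{m₁}(2[(jl₁−d+1)∕2 + d%2]_q − 2[d−1+d%2]_q) − 2·Σ_{band} q^{a + ⌊jl₁∕2⌋}`

Cell `hodgecm-mathlib` (D-0151), FLOOR 0, crux item H413 = `stmt-HodgeConjecture-24833`, route of record `HCCMUnconditional`; squad F0∕P3c∕LH4; lane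
`--supports stmt-HodgeConjecture-24833 --as helper` (count-neutral; pays NO tier-0 row).  THEOREMS ONLY (no `def`, no instance, no notation, no `sorry`, default heartbeats).
OWNER'S ORGAN №7 for the END `levels_typeTwo_censusLaw` — the odd-`a′` twin of ★ (this seat) `…RamKWeldCut.toricCensusSum_ramK_weld_cut`.

THE OBJECT.  For a piece `lev_{a′,b′}` with ODD `a′` (lev_lo at odd `d`, lev_hi at even `d`) the scaled tokens `(m₁, jl₁) = (m − a′, jλ − a′)` of the cone multiplier
`μ₁ = t⁻¹(λ − u)` sit in the FLIPPED parity class `jl₁ ≡ m₁ ≢ d` of ★ p859875 (LH4-p04 (g7), (T5s♭-RamK): value `q^m(2[(jl−d+1)∕2 + d%2]_q − 2[d−1+d%2]_q)`, guards `3d ≤ jl + 3`,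
`d ≤ m + 1`, same `ε` window; `_flip_cut` = that minus ★ p859753's cut band).  THIS FILE repeats the two steps of the even-`a′` lane on top of it:
* §1 `toricCensusSum_ramK_flip_cut_offset` — ★ p859875 `toricCensusSum_ramK_flip_cut`'s binders with the top rows' alive condition shifted to `2j + d ≤ 2jl + 1 + e` (`hvTopE`)
  + `hCe : C + d ≤ m + jl + 1` ⊢ the same value (re-cut tables, ★ p859832 `cutSum_eq_of_agree_below_alive`, ★ p859875);
* §2 **`toricCensusSum_ramK_weld_cut_flip`** — ★ g33 `toricCensusSum_ramK_weld`'s one-field frame and letters VERBATIM + the `ρ`-fixed scaling element `t` (`|t| = exp(−e)`, `e` ODD,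
  `e ≤ d`), scaled tokens `m₁ + e = m`, `jl₁ + e = jλ` with ★ p859875's guards, cutoff `jl₁ ≤ C`, `C + d ≤ m₁ + jl₁ + 1` ⊢ the CUT census difference of the two line models over the
  cells of `μ₁` = the flipped T5s value at `(m₁, jl₁)` minus the cut top band.  Proof = the even lane's (★ (D0)–(D2) at `(m₁, jl₁)`, ★ p859867 (D3♯) top rows, ★
  `add_le_of_not_topBit_far` window) summed by §1.  (adapted from ★ `F0P3cDyRamToricCensusSumRamKWeld` §2, F0P3-p01 (g33).)
HONEST LABEL.  Count-neutral; one-field frame, no CM place, no law asserted; `HC_CM` is proved only modulo the 7 printed citations (2 remaining named inputs: hLiu418 =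
`stmt-HodgeConjecture-24832`, h413 = `stmt-HodgeConjecture-24833`) until rung 0 closes.

## References
* [Kottwitz1986BaseChangeUnits] R. E. Kottwitz, *Base change for unit elements of Hecke algebras*, Compositio Math. 60 (1986): §1 pp. 240–241.
* [Rogawski1990] J. D. Rogawski, *Automorphic Representations of Unitary Groups in Three Variables*, Ann. of Math. Stud. 123 (1990): §4.9 Prop. 4.9.1 (b) p. 55, Lemma 4.9.3 p. 56.
* [Flicker1998UnitaryFL] Y. Z. Flicker, *Elementary proof of the fundamental lemma for a unitary group*, Canad. J. Math. 50 (1998): Prop. 7 p. 84.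
* [Serre1979] J.-P. Serre, *Local Fields*, GTM 67 (1979): Ch. V §3 Prop. 5, Cor. 3.
-/

set_option autoImplicit false

namespace Summit.HodgeConjecture.HodgeConjecture.Cruxes.H413.F0P3cDyRamToricCensusSumRamKWeldCutFlip

open WithZero IsLocalRing Finset
open scoped Valued
open Literature.NumberTheory.Automorphic.UnitaryThreeFourFrame (IsRamifiedQuadraticDatum)
open Literature.NumberTheory.LocalFields.QuadraticOrder (exists_eq_varpi_zpow_mul_unit v_varpi_zpow exists_unit_twist_eq_of_isotropic)
open Literature.NumberTheory.LocalFields.WildQuadraticDatum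
open Summit.HodgeConjecture.HodgeConjecture.Cruxes.H413.F0P3cDyRamToricCensusDefs
open Summit.HodgeConjecture.HodgeConjecture.Cruxes.H413.F0P3cDyRamToricLevelCensusUnr
  (token_kappa ncard_levelSetDep_zero ncard_levelSetDep_offDiag ncard_levelSetDep_diag_low)
open Summit.HodgeConjecture.HodgeConjecture.Cruxes.H413.F0P3cDyRamToricLevelCensusRamKAtThirdField (exists_thirdFieldPackage_ramK)
open Summit.HodgeConjecture.HodgeConjecture.Cruxes.H413.F0P3cDyRamToricLevelCensusRamK
open Summit.HodgeConjecture.HodgeConjecture.Cruxes.H413.F0P3cDyRamToricLevelCensusRamKTopValueScaled (ncard_levelSetDep_top_ramK_eq_inv_mul)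
open Summit.HodgeConjecture.HodgeConjecture.Cruxes.H413.F0P3cDyRamToricCensusSumRamKCutOffset (cutSum_eq_of_agree_below_alive)
open Summit.HodgeConjecture.HodgeConjecture.Cruxes.H413.F0P3cDyRamToricCensusSumRamKFlip (toricCensusSum_ramK_flip_cut)

variable {K : Type} [Field K] [Valued K ℤᵐ⁰] {ρ Θ : K →+* K} {α ϖE : K}

/-! ## §1 The flipped cut weld with an alive offset (abstract tables) -/

/-- **(T5-P-coneΔ-R2)-RamK WITH AN ALIVE OFFSET, FLIPPED PARITY CLASS** (`jl ≡ m ≢ d`).  ★ p859875 `toricCensusSum_ramK_flip_cut`'s binders with the top rows' alive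
condition SHIFTED to `2j + d ≤ 2jl + 1 + e` (`hvTopE`, any `e : ℕ`) + `(C) (hC : jl ≤ C) (hCe : C + d ≤ m + jl + 1)` (the offset band is cut): the cut weld has ★ p859875's
flipped value VERBATIM (re-cut tables, ★ p859832 `cutSum_eq_of_agree_below_alive`, ★ p859875). [cite: Kottwitz1986BaseChangeUnits, §1 pp. 240–241]
[cite: Rogawski1990, §4.9 Prop. 4.9.1 (b) p. 55, Lemma 4.9.3 p. 56] [cite: Flicker1998UnitaryFL, Prop. 7 p. 84] -/
theorem toricCensusSum_ramK_flip_cut_offset (q : ℕ) {d jl m : ℕ} (ε : ℚ) (hq : 2 ≤ q) (hd : 2 ≤ d) (hjl : jl % 2 = (d + 1) % 2) (hjlS : 3 * d ≤ jl + 3)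
    (hpar : m % 2 = (d + 1) % 2) (hmS : d ≤ m + 1) (hm : m ≤ jl) (hε : ε = 1 ∨ (ε = -1 ∧ jl + 2 ≤ m + 2 * d))
    (nP nM vP vM : ℕ → ℕ → ℚ)
    (hnP : ∀ j a, nP j a = ((if j = 0 then (if a = 0 then 1 else 0) else if j < a ∨ (j - a) % 2 = 1 then 0
      else if a = j then (if 2 ≤ d then q ^ j else (q - 1) * q ^ (j - 1)) else if a = 0 then (if 2 * d ≤ j + 1 then 2 else 1) * q ^ (j / 2)
      else if j - a + 2 < 2 * d then (q - 1) * q ^ (j - 1 - (j - a) / 2) else if j - a + 2 = 2 * d then (q - 2) * q ^ (j - d)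
      else 2 * (q - 1) * q ^ (j - 1 - (j - a) / 2) : ℕ) : ℚ))
    (hnM : ∀ j a, nM j a = ((if j = 0 then (if a = 0 then 1 else 0) else if j < a ∨ (j - a) % 2 = 1 then 0
      else if a = j then (if 2 ≤ d then q ^ j else (q + 1) * q ^ (j - 1)) else if a = 0 then (if j + 2 ≤ 2 * d then q ^ (j / 2) else 0)
      else if j - a + 2 < 2 * d then (q - 1) * q ^ (j - 1 - (j - a) / 2) else if j - a + 2 = 2 * d then q ^ (j - d + 1) else 0 : ℕ) : ℚ))
    (hvGen : ∀ j a, (a ≤ m ∧ (j + a ≤ m ∨ (2 * a ≤ m ∧ j + a ≤ jl))) → vP j a = nP j a ∧ vM j a = nM j a)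
    (hvOff : ∀ j a, ¬ (a ≤ m ∧ (j + a ≤ m ∨ (2 * a ≤ m ∧ j + a ≤ jl))) → j + m ≠ jl + a → vP j a = 0 ∧ vM j a = 0)
    (e : ℕ)
    (hvTopE : ∀ j a, ¬ (a ≤ m ∧ (j + a ≤ m ∨ (2 * a ≤ m ∧ j + a ≤ jl))) → j + m = jl + a →
      (vP j a = if 2 * j + d ≤ 2 * jl + 1 + e ∧ (j + a + 2 ≤ m + 2 * d ∨ ε = 1) then (if j + a + 2 ≤ m + 2 * d then 1 else 2) * (q : ℚ) ^ (j - (j + a - m + 1) / 2) else 0) ∧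
      (vM j a = if 2 * j + d ≤ 2 * jl + 1 + e ∧ (j + a + 2 ≤ m + 2 * d ∨ ε = -1) then (if j + a + 2 ≤ m + 2 * d then 1 else 2) * (q : ℚ) ^ (j - (j + a - m + 1) / 2) else 0))
    (C : ℕ) (hC : jl ≤ C) (hCe : C + d ≤ m + jl + 1) :
    ε * ∑ j ∈ range (jl + 1), ∑ a ∈ range (jl + 2), (q : ℚ) ^ a * (if j + a ≤ C then vP j a - vM j a else 0) =
      (q : ℚ) ^ m * (2 * ∑ i ∈ range ((jl - d + 1) / 2 + d % 2), (q : ℚ) ^ i - 2 * ∑ i ∈ range (d - 1 + d % 2), (q : ℚ) ^ i) -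
        2 * ∑ a ∈ (range (jl + 2)).filter (fun a => a ≤ m ∧ C + m < jl + 2 * a ∧ 2 * m + 2 * d < jl + 2 * a + 2 ∧ 2 * a + d ≤ 2 * m + 1), (q : ℚ) ^ (a + jl / 2) := by
  classical
  -- the standard-alive tables: the given ones, re-cut at `2j + d ≤ 2jl + 1` on the top diagonal
  set wP : ℕ → ℕ → ℚ := fun j a => if ¬ (a ≤ m ∧ (j + a ≤ m ∨ (2 * a ≤ m ∧ j + a ≤ jl))) ∧ j + m = jl + a then
      (if 2 * j + d ≤ 2 * jl + 1 ∧ (j + a + 2 ≤ m + 2 * d ∨ ε = 1) then (if j + a + 2 ≤ m + 2 * d then 1 else 2) * (q : ℚ) ^ (j - (j + a - m + 1) / 2) else 0)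
    else vP j a with hwP
  set wM : ℕ → ℕ → ℚ := fun j a => if ¬ (a ≤ m ∧ (j + a ≤ m ∨ (2 * a ≤ m ∧ j + a ≤ jl))) ∧ j + m = jl + a then
      (if 2 * j + d ≤ 2 * jl + 1 ∧ (j + a + 2 ≤ m + 2 * d ∨ ε = -1) then (if j + a + 2 ≤ m + 2 * d then 1 else 2) * (q : ℚ) ^ (j - (j + a - m + 1) / 2) else 0)
    else vM j a with hwM
  have hwGen : ∀ j a, (a ≤ m ∧ (j + a ≤ m ∨ (2 * a ≤ m ∧ j + a ≤ jl))) → wP j a = nP j a ∧ wM j a = nM j a := fun j a hg => by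
    obtain ⟨h1, h2⟩ := hvGen j a hg
    rw [hwP, hwM]; dsimp only
    rw [if_neg (fun h => h.1 hg), if_neg (fun h => h.1 hg), h1, h2]
    exact ⟨rfl, rfl⟩
  have hwOff : ∀ j a, ¬ (a ≤ m ∧ (j + a ≤ m ∨ (2 * a ≤ m ∧ j + a ≤ jl))) → j + m ≠ jl + a → wP j a = 0 ∧ wM j a = 0 := fun j a hg hoff => by
    obtain ⟨h1, h2⟩ := hvOff j a hg hoff
    rw [hwP, hwM]; dsimp only
    rw [if_neg (fun h => hoff h.2), if_neg (fun h => hoff h.2), h1, h2]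
    exact ⟨rfl, rfl⟩
  have hwTop : ∀ j a, ¬ (a ≤ m ∧ (j + a ≤ m ∨ (2 * a ≤ m ∧ j + a ≤ jl))) → j + m = jl + a →
      (wP j a = if 2 * j + d ≤ 2 * jl + 1 ∧ (j + a + 2 ≤ m + 2 * d ∨ ε = 1) then (if j + a + 2 ≤ m + 2 * d then 1 else 2) * (q : ℚ) ^ (j - (j + a - m + 1) / 2) else 0) ∧
      (wM j a = if 2 * j + d ≤ 2 * jl + 1 ∧ (j + a + 2 ≤ m + 2 * d ∨ ε = -1) then (if j + a + 2 ≤ m + 2 * d then 1 else 2) * (q : ℚ) ^ (j - (j + a - m + 1) / 2) else 0) :=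
    fun j a hg htop => by
    have hc : ¬ (a ≤ m ∧ (j + a ≤ m ∨ (2 * a ≤ m ∧ j + a ≤ jl))) ∧ j + m = jl + a := ⟨hg, htop⟩
    rw [hwP, hwM]; dsimp only
    rw [if_pos hc, if_pos hc]
    exact ⟨rfl, rfl⟩
  -- the two cut sums agree: the tables differ only on top cells beyond the standard alive boundary, and those are cut
  have hagree : ∀ j a, ¬ (j + m = jl + a ∧ 2 * jl + 1 < 2 * j + d) → vP j a = wP j a ∧ vM j a = wM j a := fun j a hna => by
    rw [hwP, hwM]; dsimp only
    by_cases hcase : ¬ (a ≤ m ∧ (j + a ≤ m ∨ (2 * a ≤ m ∧ j + a ≤ jl))) ∧ j + m = jl + a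
    · rw [if_pos hcase, if_pos hcase]
      obtain ⟨hP, hM⟩ := hvTopE j a hcase.1 hcase.2
      have halive : 2 * j + d ≤ 2 * jl + 1 := by
        by_contra hlt
        exact hna ⟨hcase.2, by omega⟩
      have hiffP : (2 * j + d ≤ 2 * jl + 1 + e ∧ (j + a + 2 ≤ m + 2 * d ∨ ε = 1)) ↔ (2 * j + d ≤ 2 * jl + 1 ∧ (j + a + 2 ≤ m + 2 * d ∨ ε = 1)) := by
        constructor <;> rintro ⟨h1, h2⟩ <;> exact ⟨by omega, h2⟩
      have hiffM : (2 * j + d ≤ 2 * jl + 1 + e ∧ (j + a + 2 ≤ m + 2 * d ∨ ε = -1)) ↔ (2 * j + d ≤ 2 * jl + 1 ∧ (j + a + 2 ≤ m + 2 * d ∨ ε = -1)) := by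
        constructor <;> rintro ⟨h1, h2⟩ <;> exact ⟨by omega, h2⟩
      rw [hP, hM, if_congr hiffP rfl rfl, if_congr hiffM rfl rfl]
      exact ⟨rfl, rfl⟩
    · rw [if_neg hcase, if_neg hcase]
      exact ⟨rfl, rfl⟩
  rw [cutSum_eq_of_agree_below_alive (q : ℚ) hCe vP vM wP wM hagree]
  exact toricCensusSum_ramK_flip_cut q ε hq hd hjl hjlS hpar hmS hm hε nP nM wP wM hnP hnM hwGen hwOff hwTop C hC


/-! ## §2 The level-piece weld, flipped parity class -/

/-- **(T5-P-weldΔ)-RamK♭: THE LEVEL-PIECE WELD ON TYPE RamK, FLIPPED PARITY CLASS.**  ★ g33 `toricCensusSum_ramK_weld`'s frame and letters (one-field RamK frame,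
`h` hyperbolic, `h′` anisotropic, `(λ, u)` with unscaled tokens `(m, jλ)`, side letter `hside`), plus the `ρ`-fixed scaling element `tc` (`|tc| = exp(−e)`, `e` ODD, `e ≤ d`),
the scaled tokens `m₁ + e = m`, `jl₁ + e = jλ` with ★ p859875's guards `3d ≤ jl₁ + 3`, `d ≤ m₁ + 1`, and a cutoff `C` with `jl₁ ≤ C`, `C + d ≤ m₁ + jl₁ + 1`.  Then the CUT
census difference of the two line models over the cells of `μ₁ = tc⁻¹(λ − u)` is the FLIPPED T5s value at `(m₁, jl₁)` minus the cut top band (§1).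
[cite: Kottwitz1986BaseChangeUnits, §1 pp. 240–241] [cite: Rogawski1990, §4.9 Prop. 4.9.1 (b) p. 55, Lemma 4.9.3 p. 56] [cite: Flicker1998UnitaryFL, Prop. 7 p. 84] [cite: Serre1979, Ch. V §3 Prop. 5, Cor. 3] -/
theorem toricCensusSum_ramK_weld_cut_flip [CompleteSpace K] [IsDiscreteValuationRing 𝒪[K]] [Finite 𝓀[K]]
    (hρρ : ∀ x, ρ (ρ x) = x) (hvρ : ∀ x, Valued.v (ρ x) = Valued.v x) (hΘρ : ∀ x, Θ (ρ x) = ρ (Θ x))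
    (hα1 : Valued.v α ≤ 1) (hα : Valued.v (α - ρ α) = 1) {d t : ℕ} (hD : IsRamifiedQuadraticDatum Θ ϖE d t) (hρϖ : ρ ϖE = ϖE)
    {q : ℕ} (hq : Nat.card 𝓀[K] = q ^ 2)
    (hσres : ∀ z : K, ρ z = z → Valued.v z ≤ 1 → Valued.v (Θ z - z) < 1) (hram : Valued.v (α - Θ α) < 1)
    {h h' : K} (hΘh : Θ h = h) (hh : h ≠ 0) (hhyper : ∃ x : K, x ≠ 0 ∧ h * Θ x * x + ρ (h * Θ x * x) = 0)
    (hΘh' : Θ h' = h') (hh' : h' ≠ 0) (haniso : ¬ ∃ x : K, x ≠ 0 ∧ h' * Θ x * x + ρ (h' * Θ x * x) = 0)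
    {lam u : K} (hlam : lam * Θ lam = 1) (hu : ρ u = u) (hu1 : u * Θ u = 1)
    {m jl : ℕ} (hm : Valued.v (lam - u) = exp (-(m : ℤ))) (hjl : Valued.v ((lam - u) - ρ (lam - u)) = exp (-(jl : ℤ)))
    (hd2 : 2 ≤ d) (hmpar : m % 2 = d % 2)
    {tc : K} (hρt : ρ tc = tc) {e : ℕ} (hte : Valued.v tc = exp (-(e : ℤ))) (he2 : e % 2 = 1) (hed : e ≤ d)
    {m₁ jl₁ : ℕ} (hme : m₁ + e = m) (hjle : jl₁ + e = jl) (hjlS : 3 * d ≤ jl₁ + 3) (hmS : d ≤ m₁ + 1)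
    (ε : ℚ) (hε1 : ε = 1 ∨ ε = -1)
    (hside : 3 * d ≤ jl + 2 → ∃ c₀ : ℕ, 2 * d ≤ c₀ + 1 ∧ c₀ + d ≤ jl + 1 ∧
      (ε = 1 ↔ ∃ ω₁ : Kˣ, Valued.v (ω₁ : K) = 1 ∧
        Valued.v (1 + ρ h / h / (ρ (lam - u) / (lam - u)) * (ρ ((ω₁ : K) * Θ ω₁) / ((ω₁ : K) * Θ ω₁))) ≤ exp (-(c₀ : ℤ))))
    (C : ℕ) (hC : jl₁ ≤ C) (hCe : C + d ≤ m₁ + jl₁ + 1) :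
    ε * ∑ j ∈ range (jl₁ + 1), ∑ a ∈ range (jl₁ + 2), (q : ℚ) ^ a *
        (if j + a ≤ C then ((levelSetDep ρ Θ α ϖE h j a (tc⁻¹ * (lam - u))).ncard : ℚ) - ((levelSetDep ρ Θ α ϖE h' j a (tc⁻¹ * (lam - u))).ncard : ℚ) else 0) =
      (q : ℚ) ^ m₁ * (2 * ∑ i ∈ range ((jl₁ - d + 1) / 2 + d % 2), (q : ℚ) ^ i - 2 * ∑ i ∈ range (d - 1 + d % 2), (q : ℚ) ^ i) -
        2 * ∑ a ∈ (range (jl₁ + 2)).filter (fun a => a ≤ m₁ ∧ C + m₁ < jl₁ + 2 * a ∧ 2 * m₁ + 2 * d < jl₁ + 2 * a + 2 ∧ 2 * a + d ≤ 2 * m₁ + 1),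
          (q : ℚ) ^ (a + jl₁ / 2) := by
  classical
  -- ## the datum's clauses and the third field
  have hΘΘ : ∀ x, Θ (Θ x) = x := hD.1
  have hvΘ : ∀ x, Valued.v (Θ x) = Valued.v x := hD.2.1
  have hϖE : Valued.v ϖE = exp (-1 : ℤ) := hD.2.2.1
  have hΘev : ∀ x : K, Θ x = x → x ≠ 0 → ∃ n : ℤ, Valued.v x = exp (2 * n) := hD.2.2.2.1
  have hdatum : Valued.v (ϖE - Θ ϖE) = Valued.v ϖE ^ d := hD.2.2.2.2.1
  obtain ⟨K', _, _, σ', α', π', jK, hDVR, hfin, hcs, hσ', hvσ', hα'1, hα', hπ', hq', hjv, hjΘ, hjfix, hjσ⟩ :=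
    exists_thirdFieldPackage_ramK hρρ hvρ hΘρ hα1 hα hD hq hσres hram
  haveI := hDVR
  haveI := hfin
  haveI := hcs
  -- ## token bookkeeping
  obtain ⟨-, -, -, hκΘ, hmjl⟩ := token_kappa hρρ hvρ hΘρ hvΘ hlam hu hu1 hm hjl
  have hjlpar : jl % 2 = d % 2 := mod_two_eq_of_v_sub_map_eq hΘΘ hϖE hdatum hΘev hκΘ
  have hmjlpar : m % 2 = jl % 2 := by rw [hmpar, hjlpar]
  -- ## the scaled multiplier `μ₁ = tc⁻¹(λ − u)`: tokens (same parity class since `e` is even)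
  have ht0 : tc ≠ 0 := fun h0 => by rw [h0, map_zero] at hte; exact (exp_ne_zero hte.symm).elim
  have hm1 : Valued.v (tc⁻¹ * (lam - u)) = exp (-(m₁ : ℤ)) := by
    rw [map_mul, map_inv₀, hte, hm, ← exp_neg, ← exp_add]; congr 1; omega
  have hjl1 : Valued.v (tc⁻¹ * (lam - u) - ρ (tc⁻¹ * (lam - u))) = exp (-(jl₁ : ℤ)) := by
    rw [show tc⁻¹ * (lam - u) - ρ (tc⁻¹ * (lam - u)) = tc⁻¹ * ((lam - u) - ρ (lam - u)) by rw [map_mul, map_inv₀, hρt]; ring,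
      map_mul, map_inv₀, hte, hjl, ← exp_neg, ← exp_add]; congr 1; omega
  have hjl₁par : jl₁ % 2 = (d + 1) % 2 := by omega
  have hm₁par : m₁ % 2 = (d + 1) % 2 := by omega
  have hm₁jl₁ : m₁ ≤ jl₁ := by omega
  have hq2 : 2 ≤ q := by
    have h1 : 1 < Nat.card 𝓀[K] := Finite.one_lt_card
    rw [hq] at h1
    by_contra hlt
    interval_cases q <;> simp at h1
  have hε : ε = 1 ∨ (ε = -1 ∧ jl₁ + 2 ≤ m₁ + 2 * d) := by
    rcases hε1 with h1 | h1
    · exact Or.inl h1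
    · refine Or.inr ⟨h1, ?_⟩
      suffices hw : jl + 2 ≤ m + 2 * d by omega
      by_cases hfar : 3 * d ≤ jl + 2
      · obtain ⟨c₀, hc₀far, hc₀D, hSc₀⟩ := hside hfar
        have hnot : ¬ ∃ ω₁ : Kˣ, Valued.v (ω₁ : K) = 1 ∧
            Valued.v (1 + ρ h / h / (ρ (lam - u) / (lam - u)) * (ρ ((ω₁ : K) * Θ ω₁) / ((ω₁ : K) * Θ ω₁))) ≤ exp (-(c₀ : ℤ)) :=
          fun hb => by have := hSc₀.2 hb; rw [h1] at this; norm_num at this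
        exact add_le_of_not_topBit_far hρρ hvρ hΘρ hD hρϖ hσ' hvσ' hα'1 hα' hπ' jK hjv hjΘ hjfix hjσ hΘh hh hhyper hΘh' hh' haniso
          hlam hu hu1 hm hjl hc₀far hc₀D hnot
      · omega
  -- ## the ★ heads, abbreviated
  have HP := fun j a => ncard_levelSet_ramK_hyper hρρ hvρ hΘρ hα1 hα hD hρϖ hΘh hh hq hσ' hvσ' hα'1 hα' hπ' hq' jK hjv hjΘ hjfix hjσ hhyper j a
  have HM := fun j a => ncard_levelSet_ramK_aniso hρρ hvρ hΘρ hα1 hα hD hρϖ hΘh' hh' hq hσ' hvσ' hα'1 hα' hπ' hq' jK hjv hjΘ hjfix hjσ haniso j a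
  have HT : ∀ j a, j ≤ jl₁ → 1 ≤ a → j + m₁ = jl₁ + a → m₁ + 1 ≤ 2 * a → _ := fun j a hj ha hdiag htop =>
    ncard_levelSetDep_top_ramK_eq_inv_mul hρρ hvρ hΘρ hα1 hα hD hρϖ hq hσ' hvσ' hα'1 hα' hπ' hq' jK hjv hjΘ hjfix hjσ hΘh hh hhyper hΘh' hh' haniso
      hlam hu hu1 hm hjl hmjlpar hd2 hρt hte hme hjle (S := ε = 1) hside hj ha hdiag htop
  -- ## the tables
  obtain ⟨nP, hnPdef⟩ : ∃ f : ℕ → ℕ → ℚ, f = fun j a => ((levelSet ρ Θ α ϖE h j a).ncard : ℚ) := ⟨_, rfl⟩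
  obtain ⟨nM, hnMdef⟩ : ∃ f : ℕ → ℕ → ℚ, f = fun j a => ((levelSet ρ Θ α ϖE h' j a).ncard : ℚ) := ⟨_, rfl⟩
  obtain ⟨vP, hvPdef⟩ : ∃ f : ℕ → ℕ → ℚ, f = fun j a => if j ≤ jl₁ then ((levelSetDep ρ Θ α ϖE h j a (tc⁻¹ * (lam - u))).ncard : ℚ) else 0 := ⟨_, rfl⟩
  obtain ⟨vM, hvMdef⟩ : ∃ f : ℕ → ℕ → ℚ, f = fun j a => if j ≤ jl₁ then ((levelSetDep ρ Θ α ϖE h' j a (tc⁻¹ * (lam - u))).ncard : ℚ) else 0 := ⟨_, rfl⟩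
  -- (1) the u-free tables
  have hnP : ∀ j a, nP j a = ((if j = 0 then (if a = 0 then 1 else 0) else if j < a ∨ (j - a) % 2 = 1 then 0
      else if a = j then (if 2 ≤ d then q ^ j else (q - 1) * q ^ (j - 1)) else if a = 0 then (if 2 * d ≤ j + 1 then 2 else 1) * q ^ (j / 2)
      else if j - a + 2 < 2 * d then (q - 1) * q ^ (j - 1 - (j - a) / 2) else if j - a + 2 = 2 * d then (q - 2) * q ^ (j - d)
      else 2 * (q - 1) * q ^ (j - 1 - (j - a) / 2) : ℕ) : ℚ) := fun j a => by rw [hnPdef]; dsimp only; rw [HP j a]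
  have hnM : ∀ j a, nM j a = ((if j = 0 then (if a = 0 then 1 else 0) else if j < a ∨ (j - a) % 2 = 1 then 0
      else if a = j then (if 2 ≤ d then q ^ j else (q + 1) * q ^ (j - 1)) else if a = 0 then (if j + 2 ≤ 2 * d then q ^ (j / 2) else 0)
      else if j - a + 2 < 2 * d then (q - 1) * q ^ (j - 1 - (j - a) / 2) else if j - a + 2 = 2 * d then q ^ (j - d + 1) else 0 : ℕ) : ℚ) :=
    fun j a => by rw [hnMdef]; dsimp only; rw [HM j a]
  -- empty u-free cells for `j < a`
  have hnP0 : ∀ j a, j < a → nP j a = 0 := fun j a hja => by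
    rw [hnP]; split_ifs <;> first | rfl | (exfalso; omega)
  have hnM0 : ∀ j a, j < a → nM j a = 0 := fun j a hja => by
    rw [hnM]; split_ifs <;> first | rfl | (exfalso; omega)
  -- (2) `hvGen`
  have hvGen : ∀ j a, (a ≤ m₁ ∧ (j + a ≤ m₁ ∨ (2 * a ≤ m₁ ∧ j + a ≤ jl₁))) → vP j a = nP j a ∧ vM j a = nM j a := by
    intro j a hgen
    have hj : j ≤ jl₁ := by omega
    rw [hvPdef, hvMdef, hnPdef, hnMdef]; dsimp only; rw [if_pos hj, if_pos hj]
    rcases Nat.eq_zero_or_pos a with rfl | ha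
    · rw [ncard_levelSetDep_zero hρρ hvρ hΘΘ hΘρ hvΘ hα1 hα hρϖ hϖE hh hm1 hjl1 hj,
        ncard_levelSetDep_zero hρρ hvρ hΘΘ hΘρ hvΘ hα1 hα hρϖ hϖE hh' hm1 hjl1 hj]
      exact ⟨rfl, rfl⟩
    · by_cases hdiag : j + m₁ = jl₁ + a
      · rw [ncard_levelSetDep_diag_low hρρ hvρ hΘΘ hΘρ hvΘ hα1 hα hρϖ hϖE hh hm1 hjl1 ha hdiag (by omega),
          ncard_levelSetDep_diag_low hρρ hvρ hΘΘ hΘρ hvΘ hα1 hα hρϖ hϖE hh' hm1 hjl1 ha hdiag (by omega)]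
        exact ⟨rfl, rfl⟩
      · rw [ncard_levelSetDep_offDiag hρρ hvρ hΘΘ hΘρ hvΘ hα1 hα hρϖ hϖE hh hm1 hjl1 ha hdiag,
          ncard_levelSetDep_offDiag hρρ hvρ hΘΘ hΘρ hvΘ hα1 hα hρϖ hϖE hh' hm1 hjl1 ha hdiag]
        by_cases hP : 2 * a ≤ m₁ ∧ (j + a ≤ m₁ ∨ j + a ≤ jl₁)
        · rw [if_pos hP, if_pos hP]; exact ⟨rfl, rfl⟩
        · have hja : j < a := by omega
          have h1 := hnP0 j a hja
          have h2 := hnM0 j a hja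
          rw [hnPdef] at h1; rw [hnMdef] at h2; dsimp only at h1 h2
          rw [if_neg hP, if_neg hP, Nat.cast_zero, h1, h2]
          exact ⟨rfl, rfl⟩
  -- (3) `hvOff`
  have hvOff : ∀ j a, ¬ (a ≤ m₁ ∧ (j + a ≤ m₁ ∨ (2 * a ≤ m₁ ∧ j + a ≤ jl₁))) → j + m₁ ≠ jl₁ + a → vP j a = 0 ∧ vM j a = 0 := by
    intro j a hgen hoff
    rw [hvPdef, hvMdef]; dsimp only
    by_cases hj : j ≤ jl₁
    · rw [if_pos hj, if_pos hj]
      have ha : 1 ≤ a := by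
        by_contra h0
        exact hgen ⟨by omega, Or.inr ⟨by omega, by omega⟩⟩
      rw [ncard_levelSetDep_offDiag hρρ hvρ hΘΘ hΘρ hvΘ hα1 hα hρϖ hϖE hh hm1 hjl1 ha hoff,
        ncard_levelSetDep_offDiag hρρ hvρ hΘΘ hΘρ hvΘ hα1 hα hρϖ hϖE hh' hm1 hjl1 ha hoff]
      have hP : ¬ (2 * a ≤ m₁ ∧ (j + a ≤ m₁ ∨ j + a ≤ jl₁)) := fun hP => hgen ⟨by omega, by omega⟩
      rw [if_neg hP, if_neg hP, Nat.cast_zero]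
      exact ⟨rfl, rfl⟩
    · rw [if_neg hj, if_neg hj]; exact ⟨rfl, rfl⟩
  -- (4) `hvTop`
  have hvTop : ∀ j a, ¬ (a ≤ m₁ ∧ (j + a ≤ m₁ ∨ (2 * a ≤ m₁ ∧ j + a ≤ jl₁))) → j + m₁ = jl₁ + a →
      (vP j a = if 2 * j + d ≤ 2 * jl₁ + 1 + e ∧ (j + a + 2 ≤ m₁ + 2 * d ∨ ε = 1) then (if j + a + 2 ≤ m₁ + 2 * d then 1 else 2) * (q : ℚ) ^ (j - (j + a - m₁ + 1) / 2) else 0) ∧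
      (vM j a = if 2 * j + d ≤ 2 * jl₁ + 1 + e ∧ (j + a + 2 ≤ m₁ + 2 * d ∨ ε = -1) then (if j + a + 2 ≤ m₁ + 2 * d then 1 else 2) * (q : ℚ) ^ (j - (j + a - m₁ + 1) / 2) else 0) := by
    intro j a hgen hdiag
    rw [hvPdef, hvMdef]; dsimp only
    by_cases hj : j ≤ jl₁
    · have ha : 1 ≤ a := by
        by_contra h0
        exact hgen ⟨by omega, Or.inr ⟨by omega, by omega⟩⟩
      have htop : m₁ + 1 ≤ 2 * a := by
        by_contra hlow
        exact hgen ⟨by omega, Or.inr ⟨by omega, by omega⟩⟩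
      obtain ⟨HTP, HTM⟩ := HT j a hj ha hdiag htop
      rw [if_pos hj, if_pos hj, HTP, HTM]
      have hneg : (¬ ε = 1) ↔ ε = -1 := by
        rcases hε1 with h1 | h1
        · rw [h1]; norm_num
        · rw [h1]; norm_num
      constructor
      · push_cast; rfl
      · push_cast
        by_cases hc : 2 * j + d ≤ 2 * jl₁ + 1 + e ∧ (j + a + 2 ≤ m₁ + 2 * d ∨ ε = -1)
        · rw [if_pos hc, if_pos (⟨hc.1, hc.2.imp id hneg.2⟩ : 2 * j + d ≤ 2 * jl₁ + 1 + e ∧ (j + a + 2 ≤ m₁ + 2 * d ∨ ¬ ε = 1))]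
        · rw [if_neg hc, if_neg (fun h0 => hc ⟨h0.1, h0.2.imp id hneg.1⟩)]
    · have hfalse : ¬ (2 * j + d ≤ 2 * jl₁ + 1 + e ∧ (j + a + 2 ≤ m₁ + 2 * d ∨ ε = 1)) := fun h0 => by omega
      have hfalse' : ¬ (2 * j + d ≤ 2 * jl₁ + 1 + e ∧ (j + a + 2 ≤ m₁ + 2 * d ∨ ε = -1)) := fun h0 => by omega
      rw [if_neg hj, if_neg hj, if_neg hfalse, if_neg hfalse']
      exact ⟨rfl, rfl⟩
  -- ## the ★ T5s identity, then unfold the tables on `j ≤ jλ`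
  have key := toricCensusSum_ramK_flip_cut_offset q ε hq2 hd2 hjl₁par hjlS hm₁par hmS hm₁jl₁ hε nP nM vP vM hnP hnM hvGen hvOff e hvTop C hC hCe
  rw [← key]
  congr 1
  refine sum_congr rfl fun j hj => sum_congr rfl fun a _ => ?_
  have hj' : j ≤ jl₁ := by rw [mem_range] at hj; omega
  rw [hvPdef, hvMdef]; dsimp only; rw [if_pos hj', if_pos hj']


end Summit.HodgeConjecture.HodgeConjecture.Cruxes.H413.F0P3cDyRamToricCensusSumRamKWeldCutFlip
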